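import Mathlib
import HarnessLib
import Summits.ValiantsHypothesis.ValiantsHypothesis.Theses.MonotoneRestoration

/-!
# ValiantsHypothesis / MonotoneRestoration — `MonotoneRestorationQP`, line `Sketch`, wave 2

Support file for crux item `stmt-ValiantsHypothesis-15886`
(`Summit.ValiantsHypothesis.ValiantsHypothesis.Theses.MonotoneRestoration.MonotoneRestorationQP`),
line `Sketch`, stub `stub_crux_implies_nonInjective_monotoneHard` (kill-switch form of the crux).

The "non-injective maps" family
`NI n = ∑ ψ : Fin n → Fin n, (if Injective ψ then 0 else ∏ i, X (i, ψ i))`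
(`= ∏ i (∑ j, x i j) - per n` coefficientwise) is invariant under independent row and column
permutations and has total degree `≤ n`.  Hence the crux `MonotoneRestorationQP`, applied to `NI`,
turns a polynomial bound on the monotone circuit complexity of `NI` into quasi-polynomial
square-symmetric circuits for `NI`; so if `NI` has no such circuits (first hypothesis), the crux
predicts that `NI` is monotone-hard.

No new definitions: the family is written as the literal sum everywhere.
-/

-- `Summit.ValiantsHypothesis.ValiantsHypothesis.…` is the tree's mandated single-conjunct layout
-- (Sub = Summit), so the duplicated namespace component is intended.
set_option linter.dupNamespace false

namespace Summit.ValiantsHypothesis.ValiantsHypothesis.Theorems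

open Summit.ValiantsHypothesis.ValiantsHypothesis.Theses.MonotoneRestoration
open Literature.Computability.AlgebraicComplexity

/-- **Bisymmetry of the non-injective-maps polynomial.** Renaming `x (i, j) ↦ x (σ i, τ j)` fixes
`∑_{ψ non-injective} ∏ i, x (i, ψ i)`: the product for `ψ` becomes the product for
`τ ∘ ψ ∘ σ⁻¹`, a bijection of `Fin n → Fin n` preserving (non-)injectivity. [folklore] -/
theorem nonInjective_rename_bisymm (n : ℕ) (σ τ : Equiv.Perm (Fin n)) :
    MvPolynomial.rename (fun p : Fin n × Fin n => (σ p.1, τ p.2))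
      (∑ ψ : Fin n → Fin n, if Function.Injective ψ then (0 : MvPolynomial (Fin n × Fin n) NNReal)
        else ∏ i : Fin n, MvPolynomial.X (i, ψ i)) =
    ∑ ψ : Fin n → Fin n, if Function.Injective ψ then (0 : MvPolynomial (Fin n × Fin n) NNReal)
        else ∏ i : Fin n, MvPolynomial.X (i, ψ i) := by
  rw [map_sum]
  refine Fintype.sum_equiv (Equiv.arrowCongr σ τ) _ _ (fun ψ => ?_)
  have hinj : Function.Injective (Equiv.arrowCongr σ τ ψ) ↔ Function.Injective ψ := by
    change Function.Injective (τ ∘ ψ ∘ σ.symm) ↔ Function.Injective ψ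
    rw [Equiv.comp_injective, Equiv.injective_comp]
  by_cases hψ : Function.Injective ψ
  · rw [if_pos hψ, if_pos (hinj.mpr hψ), map_zero]
  · rw [if_neg hψ, if_neg (fun h => hψ (hinj.mp h)), map_prod]
    refine Fintype.prod_equiv σ _ _ (fun i => ?_)
    rw [MvPolynomial.rename_X, MvPolynomial.X_inj]
    change _ = (σ i, τ (ψ (σ.symm (σ i))))
    rw [Equiv.symm_apply_apply]

/-- **Degree of the non-injective-maps polynomial.** Each summand is `0` or a product of `n`
variables, so the total degree is at most `n`. [folklore] -/
theorem nonInjective_totalDegree_le (n : ℕ) :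
    (∑ ψ : Fin n → Fin n, if Function.Injective ψ then (0 : MvPolynomial (Fin n × Fin n) NNReal)
        else ∏ i : Fin n, MvPolynomial.X (i, ψ i)).totalDegree ≤ n := by
  refine MvPolynomial.totalDegree_finsetSum_le (fun ψ _ => ?_)
  split_ifs
  · simp
  · refine (MvPolynomial.totalDegree_finsetProd _ _).trans ?_
    calc ∑ i : Fin n, (MvPolynomial.X (R := NNReal) (i, ψ i)).totalDegree
        = ∑ _i : Fin n, 1 := Finset.sum_congr rfl (fun i _ => MvPolynomial.totalDegree_X _)
      _ ≤ n := by simp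

/-- **The crux predicts that `NI` is monotone-hard.** If the non-injective-maps family has no
quasi-polynomial square-symmetric circuits, then `MonotoneRestorationQP` (applied to this
bisymmetric family of total degree `≤ n`) rules out polynomial monotone circuit complexity.
[folklore] -/
theorem stub_crux_implies_nonInjective_monotoneHard :
    (¬ ∃ c : ℕ, ∀ n : ℕ, ∃ (G : Type) (_ : Fintype G)
        (C : LabelledArithCircuit ℂ (Fin n × Fin n) Unit G),
      C.IsSymmetric (Equiv.Perm (Fin n)) ∧
      C.eval (C.output ()) = MvPolynomial.map (Complex.ofRealHom.comp NNReal.toRealHom)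
        (∑ ψ : Fin n → Fin n, if Function.Injective ψ then (0 : MvPolynomial (Fin n × Fin n) NNReal)
          else ∏ i : Fin n, MvPolynomial.X (i, ψ i)) ∧
      Fintype.card G ≤ 2 ^ ((Nat.log 2 n + c) ^ c)) →
    MonotoneRestorationQP →
    ¬ ∃ c : ℕ, ∀ n : ℕ, complexity (k := NNReal)
      (∑ ψ : Fin n → Fin n, if Function.Injective ψ then (0 : MvPolynomial (Fin n × Fin n) NNReal)
        else ∏ i : Fin n, MvPolynomial.X (i, ψ i)) ≤ (n + 2) ^ c := by
  rintro hA hcrux ⟨c, hc⟩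
  refine hA (hcrux (fun n => ∑ ψ : Fin n → Fin n,
      if Function.Injective ψ then (0 : MvPolynomial (Fin n × Fin n) NNReal)
        else ∏ i : Fin n, MvPolynomial.X (i, ψ i))
    (fun n σ τ => nonInjective_rename_bisymm n σ τ) ⟨max c 1, fun n => ⟨?_, ?_⟩⟩)
  · calc (∑ ψ : Fin n → Fin n,
          if Function.Injective ψ then (0 : MvPolynomial (Fin n × Fin n) NNReal)
            else ∏ i : Fin n, MvPolynomial.X (i, ψ i)).totalDegree
        ≤ n := nonInjective_totalDegree_le n
      _ ≤ (n + 2) ^ 1 := by rw [pow_one]; omega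
      _ ≤ (n + 2) ^ max c 1 := Nat.pow_le_pow_right (by omega) (le_max_right c 1)
  · exact (hc n).trans (Nat.pow_le_pow_right (by omega) (le_max_left c 1))

end Summit.ValiantsHypothesis.ValiantsHypothesis.Theorems
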